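import Literature.Probability.FitznerVanDerHofstad2017.NobleJointTwoLevelIotaKitB1
import Literature.Probability.FitznerVanDerHofstad2017.NobleBoundsN1Class01
import HarnessLib

/-!
# Fitzner–van der Hofstad (2017), §6.1: the class `(a,b) = (0,1)` of (6.4) at `N = 1` for the `ι`-event

[FvdH17] = R. Fitzner, R. van der Hofstad, *Mean-field behavior for nearest-neighbor percolation in `d > 10`*,
Electron. J. Probab. **22** (2017), no. 43, arXiv:1506.07977v2; §6.1 proof of Lemma 5.3 (pp. 58–59):
"Case `a = 0`" of the `Ξ^ι` start, "**Case `a = 0, b = 1`.** We note that `u = w ≠ t, z` and `2dD(z−t) = 1`",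
"`b = 1`: … `z` and `t` are connected by one direct bond … the factor `p⁻¹` includes the information that `z` and
`t` are neighbors"; App. B row `a = 0, b = 1` of `A^{ι,a,b}(0,v,x,y)`:
"`δ_{x,e_ι} 𝓣_{1̲,1̲,2}(e_ι,y,0) + 𝓢_{1̲,1,1̲,1}(e_ι,x,y,0)`" (p. 75), "`Ā^{ι,a,1} = (1/p) A^{ι,a,1}`" (p. 78),
`P^{E,1} = 𝓣_{1,1̲,1}` (p. 73).

The class estimate `h2 (0,1)` of `NobleBoundsN1IotaReduce.tsum_ofReal_nobleXiIotaN_one_le_of_cls₁₂` for the event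
`E ι x = NobleJointTwoLevelIota.jointWitIota ι x`:
`J(v−u) ℙ_p^{⊗2}(jointWitIota ∩ class (0,1)) ≤ Σ_κ 𝟙{v = u+e_κ} P^{ι,0}(u,w) Ā'^{κ,0,1}(u,w,t,z) P^{E,1}(t−x,z−x)`.
Only part `I` meets class `a = 0`; on it `w = u`, start `{0 ←3→ e_ι} ∘ {e_ι↔u} ∘ {e_ι↔u} ≤ P^{ι,0}(u,u)`
(`NobleBoundsN1IotaStart.piPerc_iotaStart_zero_le_blockPiota`, as in `NobleBoundsN1IotaCls00/02`).  DOUBLY absorbed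
style of the column `b = 1` (`NobleJointTwoLevelIotaKitB1`, after `NobleBoundsN1Class01` for the plain joint event):
the pivotal bond `b₀ = (u,v)` and the bond `(t,z)` are absorbed on level `0` (lines `{u ←1̲→ v}₀`, `{t ←1̲→ z}₀`,
the second compensated by the `p⁻¹` of `Ā^{ι,0,1}`), the level-`1` witnesses are re-routed onto the open bond
`(t,z)` (line `{t ←1̲→ z}₁` of `P^{E,1}`).  Middle piece: for `t ≠ v` the square
`{u ←1̲→ v}₀ {v ←1→ t}₁ {t ←1̲→ z}₀ {z ←1→ u}₀ ≤ 𝓢_{1̲,1,1̲,1}(e_κ, t−u, z−u, 0)`; for `t = v` the triangle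
`{u ←1̲→ v}₀ {v ←1̲→ z}₀ {z ←2→ u}₀ ≤ 𝓣_{1̲,1̲,2}(e_κ, z−u, 0)` (the level-`0` witness of `{z ↔ u}` has length
`≥ 2` since `u ∼ t ∼ z` forces `u ≁ z` by parity, `NobleBoundsN1Class01.not_adj_of_adj_adj`).  An off-lattice
bond `(t,z)` gives a null class.  Unconditional, every `d` and `p`.
-/

namespace Literature.Probability.FitznerVanDerHofstad2017

open Literature.Barriers.CriticalPhenomena Literature.Probability.Percolation Literature.Probability.LatticeModels
open Literature.Combinatorics.SimpleGraph _root_.SimpleGraph _root_.MeasureTheory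
open Literature.Probability.FitznerVanDerHofstad2017.NobleBlocks
open Literature.Probability.FitznerVanDerHofstad2017.NobleBlocks.LenIdx
open scoped ENNReal BigOperators

variable {d : ℕ}

namespace IotaCls01

/-! ### The upgraded line families of part `I` in class `(0,1)` (`w = u`) -/

/-- Level `0`, sub-case `t ≠ v`: `{0 ←3→ e}, {e ↔ u}, {u ↔ u}, {z ←1→ u}, {e ↔ u}`.
[cite: FitznerVanDerHofstad2017, §6.1 "Case a = 0", "Case a = 0, b = 1" (arXiv:1506.07977v2 p. 59)] -/
def l0n (e u z : Site d) : Fin 5 → Set (BondConfig (Site d)) :=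
  ![event (ge 3) 0 e, event (ge 0) e u, event (ge 0) u u, event (ge 1) z u, event (ge 0) e u]

/-- Level `0`, sub-case `t = v`: `{0 ←3→ e}, {e ↔ u}, {u ↔ u}, {z ←2→ u}, {e ↔ u}` (`u ≁ z` by parity).
[cite: FitznerVanDerHofstad2017, §6.1 "Case a = 0", "Case a = 0, b = 1"; App. B row a=0,b=1, index `2` of `𝓣_{1̲,1̲,2}` (arXiv:1506.07977v2 pp. 59, 75)] -/
def l0e (e u z : Site d) : Fin 5 → Set (BondConfig (Site d)) :=
  ![event (ge 3) 0 e, event (ge 0) e u, event (ge 0) u u, event (ge 2) z u, event (ge 0) e u]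

/-- Level `1`, sub-case `t ≠ v` (after re-routing onto the open bond `(t,z)`): `{v ←1→ t}, {t ←1̲→ z}, {x ←1→ t},
{z ←1→ x}`. [cite: FitznerVanDerHofstad2017, §6.1 "Case a = 0, b = 1", "b = 1" (arXiv:1506.07977v2 p. 59)] -/
def lv1n (v t z x : Site d) : Fin 4 → Set (BondConfig (Site d)) :=
  ![event (ge 1) v t, event (eq 1) t z, event (ge 1) x t, event (ge 1) z x]

/-- The twelve-line family of the sub-case `t ≠ v`: five level-`0` lines, the two absorbed bond lines
`{u ←1̲→ v}₀`, `{t ←1̲→ z}₀`, and `lv1n`. [cite: FitznerVanDerHofstad2017, §6.1 (6.4), "b = 1" (arXiv:1506.07977v2 pp. 58–59)] -/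
def mkn (L₀ : Fin 5 → Set (BondConfig (Site d))) (u v t z x : Site d) :
    (Fin 5 ⊕ Fin 2) ⊕ Fin 4 → Set (BondConfig (Site d)) :=
  Sum.elim (Sum.elim L₀ ![event (eq 1) u v, event (eq 1) t z]) (lv1n v t z x)

/-- [cite: FitznerVanDerHofstad2017, §4.2 Def. 4.1 (arXiv:1506.07977v2 p. 35)] -/
theorem isFinitary_l0n (e u z : Site d) : ∀ i, IsFinitary (l0n (d := d) e u z i) := by
  intro i; fin_cases i
  exacts [isFinitary_event (ge 3) 0 e, isFinitary_event (ge 0) e u, isFinitary_event (ge 0) u u,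
    isFinitary_event (ge 1) z u, isFinitary_event (ge 0) e u]

/-- [cite: FitznerVanDerHofstad2017, §4.2 Def. 4.1 (arXiv:1506.07977v2 p. 35)] -/
theorem isFinitary_l0e (e u z : Site d) : ∀ i, IsFinitary (l0e (d := d) e u z i) := by
  intro i; fin_cases i
  exacts [isFinitary_event (ge 3) 0 e, isFinitary_event (ge 0) e u, isFinitary_event (ge 0) u u,
    isFinitary_event (ge 2) z u, isFinitary_event (ge 0) e u]

/-- [cite: FitznerVanDerHofstad2017, §4.2 Def. 4.1 (arXiv:1506.07977v2 p. 35)] -/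
theorem isFinitary_lv1n (v t z x : Site d) : ∀ j, IsFinitary (lv1n (d := d) v t z x j) := by
  intro j; fin_cases j
  exacts [isFinitary_event (ge 1) v t, isFinitary_event (eq 1) t z, isFinitary_event (ge 1) x t,
    isFinitary_event (ge 1) z x]

/-- [cite: FitznerVanDerHofstad2017, §4.2 Def. 4.1 (arXiv:1506.07977v2 p. 35)] -/
theorem isFinitary_mkn {L₀ : Fin 5 → Set (BondConfig (Site d))} (hL : ∀ i, IsFinitary (L₀ i)) (u v t z x : Site d) :
    ∀ i, IsFinitary (mkn L₀ u v t z x i) := by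
  rintro ((i | i) | j)
  · exact hL i
  · fin_cases i
    exacts [isFinitary_event (eq 1) u v, isFinitary_event (eq 1) t z]
  · exact isFinitary_lv1n v t z x j

/-- **Level-`1` upgrade on class `b = 1`, sub-case `v ≠ t`** (`z, t ≠ x`): `{v ←1→ t}`, the witness of `{t↔z}` IS
the open bond `(t,z)`, `{x ←1→ t}`, `{z ←1→ x}`. [cite: FitznerVanDerHofstad2017, §6.1 "Case a = 0, b = 1", "b = 1" and the right triangle (arXiv:1506.07977v2 p. 59)] -/
theorem up₁n {E : Set (Fin 2 → BondConfig (Site d))} {L₀ : Fin 5 → Set (BondConfig (Site d))}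
    {u v w z t x : Site d} {a : Fin 3} (hvt : v ≠ t) (hzx : z ≠ x) (htx : t ≠ x) :
    ∀ ω ∈ E ∩ clsSet u w t z a 1, ∀ (j : Fin 4) (K : Set (Sym2 (Site d))), K ⊆ ω 1 → (∀ e ∈ K, u ∉ e) →
      K ∈ jwLines₁ v t z x j → (j = 1 → K = {s(t, z)}) → (j ≠ 1 → s(t, z) ∉ K) →
        K ∈ mkn L₀ u v t z x (Sum.inr j) := by
  intro ω hω j K _ _ hL hj _
  have htz : t ≠ z := ((mem_lineCls_one_iff t z 1 ω).1 hω.2.2).1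
  fin_cases j
  · show K ∈ event (ge 1) v t
    exact mem_openConnGe_one_of_ne (show K ∈ (openConn v t : Set (BondConfig (Site d))) from hL) hvt
  · show K ∈ event (eq 1) t z
    rw [hj rfl]
    exact mem_openConnEq_one_of_mem htz (Set.mem_singleton _)
  · show K ∈ event (ge 1) x t
    rw [event_comm]
    exact mem_openConnGe_one_of_ne (show K ∈ (openConn t x : Set (BondConfig (Site d))) from hL) htx
  · show K ∈ event (ge 1) z x
    exact mem_openConnGe_one_of_ne (show K ∈ (openConn z x : Set (BondConfig (Site d))) from hL) hzx

/-! ### The typed row and the two middle pieces -/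

/-- The row `Ā'^{κ,0,1}(u,u,t,z) = p⁻¹ (δ_{t−u,e_κ} 𝓣_{1̲,1̲,2}(e_κ, z−u, 0) + 𝓢_{1̲,1,1̲,1}(e_κ, t−u, z−u, 0))` for
`v = u + e_κ`, `z ≠ u`. [cite: FitznerVanDerHofstad2017, App. B row a=0,b=1 of `A^{ι,a,b}` (arXiv:1506.07977v2 p. 75); "Ā^{ι,a,1} = (1/p) A^{ι,a,1}" (p. 78)] -/
theorem blockAbar'_eq (p : unitInterval) {u v z : Site d} {κ : Fin d × Bool} (hv : v = u + stepVec κ) (hzu : z ≠ u)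
    (t : Site d) :
    blockAbar' (Letters.perc d p) κ 0 1 u u t z = (ENNReal.ofReal p)⁻¹ *
      (kd (t - u) (v - u) * (Letters.perc d p).T (eq 1) (eq 1) (ge 2) (v - u) (z - u) 0 +
        (Letters.perc d p).S (eq 1) (ge 1) (eq 1) (ge 1) (v - u) (t - u) (z - u) 0) := by
  have he : v - u = stepVec κ := by rw [hv, add_sub_cancel_left]
  have hne01 : ¬((0 : Fin 3) = 0 ∧ (1 : Fin 3) = 0) := by decide
  rw [blockAbar'_of_ne (Letters.perc d p) κ hne01, blockAbar, ofBase, blockAbar₀_zero_one, sub_self, kd_self,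
    kdc_of_ne (sub_ne_zero.2 hzu), one_mul, one_mul, ← he, perc_p]

/-- Middle piece, sub-case `t ≠ v`: `ℙ_p^{⊗2}(⊛ {u ←1̲→ v}₀, {v ←1→ t}₁, {t ←1̲→ z}₀, {z ←1→ u}₀) ≤
𝓢_{1̲,1,1̲,1}(v−u, t−u, z−u, 0) ≤ δ 𝓣 + 𝓢`. [cite: FitznerVanDerHofstad2017, §6.1 "Case a = 0, b = 1"; App. B row a=0,b=1 (arXiv:1506.07977v2 pp. 59, 75)] -/
theorem piPerc_mid_n_le (p : unitInterval) (u v t z : Site d) (c : Fin 4 → Fin 2) :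
    piPerc d p 2 (genDisjOcc ![event (eq 1) u v, event (ge 1) v t, event (eq 1) t z, event (ge 1) z u] c) ≤
      kd (t - u) (v - u) * (Letters.perc d p).T (eq 1) (eq 1) (ge 2) (v - u) (z - u) 0 +
        (Letters.perc d p).S (eq 1) (ge 1) (eq 1) (ge 1) (v - u) (t - u) (z - u) 0 := by
  have h := piPerc_two_genDisjOcc_le_S p (eq 1) (ge 1) (eq 1) (ge 1) u v t z u c
  rw [sub_self] at h
  exact h.trans le_add_self

/-- Middle piece, sub-case `t = v`: `ℙ_p^{⊗2}(⊛ {u ←1̲→ v}₀, {v ←1̲→ z}₀, {z ←2→ u}₀) ≤ 𝓣_{1̲,1̲,2}(v−u, z−u, 0) ≤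
δ 𝓣 + 𝓢`. [cite: FitznerVanDerHofstad2017, §6.1 "Case a = 0, b = 1": "2dD(t−z) 𝓣_{1,1̲,0}(…) ≤ Ā^{ι,0,1}"; App. B row a=0,b=1 (arXiv:1506.07977v2 pp. 59, 75)] -/
theorem piPerc_mid_e_le (p : unitInterval) {u v t : Site d} (htv : t = v) (z : Site d) (c : Fin 3 → Fin 2) :
    piPerc d p 2 (genDisjOcc ![event (eq 1) u v, event (eq 1) t z, event (ge 2) z u] c) ≤
      kd (t - u) (v - u) * (Letters.perc d p).T (eq 1) (eq 1) (ge 2) (v - u) (z - u) 0 +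
        (Letters.perc d p).S (eq 1) (ge 1) (eq 1) (ge 1) (v - u) (t - u) (z - u) 0 := by
  rw [htv, kd_self, one_mul]
  have h := piPerc_two_genDisjOcc_le_T p (eq 1) (eq 1) (ge 2) u v z u c
  rw [sub_self] at h
  exact h.trans le_self_add

end IotaCls01

open IotaCls01 in
/-- **[FvdH17] §6.1, Case `a = 0, b = 1` of (6.4) at `N = 1` for the `ι`-event** — the cell `h2 (0,1)` of
`NobleBoundsN1IotaReduce.tsum_ofReal_nobleXiIotaN_one_le_of_cls₁₂` with `E ι x := jointWitIota ι x`.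
`J(v−u) ℙ_p^{⊗2}(jointWitIota ι x u v w z t ∩ class (0,1)) ≤ Σ_κ 𝟙{v = u+e_κ} P^{ι,0}(u,w) Ā'^{κ,0,1}(u,w,t,z) P^{E,1}(t−x,z−x)`.
[cite: FitznerVanDerHofstad2017, §6.1 proof of Lemma 5.3, "Case a = 0", "Case a = 0, b = 1", "b = 1" (arXiv:1506.07977v2 pp. 58–59); App. B row a=0,b=1 (p. 75), "Ā^{ι,a,1} = (1/p) A^{ι,a,1}" (p. 78)] -/
theorem jointWitIota_cls_zero_one (p : unitInterval) (ι : Fin d × Bool) (x u v w z t : Site d) :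
    ENNReal.ofReal (bondJ d p (v - u)) * piPerc d p 2 (jointWitIota ι x u v w z t ∩ clsSet u w t z 0 1) ≤
      ∑ κ : Fin d × Bool, (if v = u + stepVec κ then (1 : ℝ≥0∞) else 0) *
        (blockPiota (Letters.perc d p) ι 0 u w * blockAbar' (Letters.perc d p) κ 0 1 u w t z *
          blockPE (Letters.perc d p) 1 (t - x) (z - x)) := by
  classical
  rw [jointWitIota_inter_eq_of_II (jointWitIotaII_inter_clsSet_zero_eq_empty ι x u v w z t 1)]
  refine ofReal_bondJ_mul_le_sum_ite p u v _ _ fun κ hv => ?_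
  by_cases hne : (jointWitIotaI ι x u v w z t ∩ clsSet u w t z 0 1).Nonempty
  swap
  · rw [Set.not_nonempty_iff_eq_empty.1 hne, measure_empty, mul_zero]; exact zero_le
  obtain ⟨ω₀, hω₀⟩ := hne
  have hs : JWιSide u v w z t x := (sideI_of_mem hω₀.1).1
  have htu : t ≠ u := hs.2.2.2.2.1
  have hzu : z ≠ u := hs.2.2.2.2.2.1
  have htz : t ≠ z := ((mem_lineCls_one_iff t z 1 ω₀).1 hω₀.2.2).1
  obtain ⟨hzx, htx⟩ := ne_and_ne_of_side_of_mem_lineCls hs (by decide) hω₀.2.2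
  have hwu : u = w := (mem_lineCls_zero_iff u w 0 ω₀).1 hω₀.2.1
  subst hwu
  have huv : u ≠ v := (adj_of_eq_add_stepVec hv).ne
  -- the bond `(t,z)` must be a lattice bond
  by_cases hadjt : (zdGraph d).Adj t z
  swap
  · rw [piPerc_eq_zero_of_not_adj₁ p (fun ω hω => ((mem_lineCls_one_iff t z 1 ω).1 hω.2.2).2) hadjt, mul_zero]
    exact zero_le
  rw [blockAbar'_eq p hv hzu t]
  refine ofReal_mul_le_of_absorb_two ?_
  have hB : MeasurableSet (jointWitIotaI ι x u v u z t ∩ clsSet u u t z 0 1) :=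
    (measurableSet_jointWitIotaI ι x u v u z t).inter (measurableSet_clsSet u u t z 0 1)
  rw [ofReal_mul_piPerc_eq_inter_of_preimage p hv hB (eraseAt0_preimage_jointWitIotaI_inter_clsSet ι x u v u z t 0 1),
    ofReal_mul_piPerc_eq_inter_tz p hadjt hB (eraseAt0_tz_preimage_jointWitIotaI_inter_cls₁ ι x u v u z t 0)]
  have hE : ∀ ω ∈ jointWitIotaI ι x u v u z t,
      JointWitnessedι (jwιLinesI (stepVec ι) u u z) {3} s((0 : Site d), stepVec ι) z v t x
        (offBonds {s(u, v)} (ω 0)) (offBonds (bondsAt {u}) (ω 1)) := fun ω hω => hω.2.2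
  by_cases htv : t = v
  · -- `t = v`: middle triangle `{u ←1̲→ v}₀ {v ←1̲→ z}₀ {z ←2→ u}₀`; `u ≁ z` by parity
    have hut : (zdGraph d).Adj u t := by rw [htv]; exact adj_of_eq_add_stepVec hv
    have h3 := piPerc_inter_le_prod₃_of_witnessedι₀₁ p (C := clsSet u u t z 0 1) hE IotaB1.cls₁_facts htu hzu
      (IotaB1.mk (l0e (stepVec ι) u z) u v t z x) (IotaB1.isFinitary_mk (isFinitary_l0e _ u z) u v t z x)
      grpιI₀₁ grpιI₀₁_adm
      (fun ω _ hlat i K hK _ hL hI _ => by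
        fin_cases i
        · exact mem_event_ge_three_zero_stepVec hlat hK hL (hI (by decide))
        · exact mem_openConnGe_zero_of_mem hL
        · exact mem_openConnGe_zero_of_mem hL
        · have hL' : K ∈ (openConn u z : Set (BondConfig (Site d))) := hL
          exact mem_openConnGe_two_of_notMem (SimpleGraph.Reachable.symm hL') hzu fun hm =>
            not_adj_of_adj_adj hut hadjt ((SimpleGraph.mem_edgeSet _).1 (hlat (hK hm))).symm
        · exact mem_openConnGe_zero_of_mem hL)
      (mem_openConnEq_one_of_mem huv (Set.mem_singleton _)) (mem_openConnEq_one_of_mem htz (Set.mem_singleton _))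
      (IotaB1.up₁ hzx htx)
    refine h3.trans (mul_le_mul' (mul_le_mul' ?_ ?_) ?_)
    · exact piPerc_grp_le _ _ _ 0 ![Sum.inl (Sum.inl 0), Sum.inl (Sum.inl 1), Sum.inl (Sum.inl 4)] (by decide)
        (by decide) (by funext m; fin_cases m <;> rfl) (piPerc_iotaStart_zero_le_blockPiota p ι u _ rfl)
    · exact piPerc_grp_le _ _ _ 1 ![Sum.inl (Sum.inr 0), Sum.inl (Sum.inr 1), Sum.inl (Sum.inl 3)]
        (by decide) (by decide) (by funext m; fin_cases m <;> rfl) (piPerc_mid_e_le p htv z _)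
    · exact piPerc_grp_le _ _ _ 2 ![Sum.inr 2, Sum.inr 1, Sum.inr 3] (by decide) (by decide)
        (by funext m; fin_cases m <;> rfl) (piPerc_end_one_le_blockPE p htx hzx _)
  · -- `t ≠ v`: middle square `{u ←1̲→ v}₀ {v ←1→ t}₁ {t ←1̲→ z}₀ {z ←1→ u}₀`
    have hvt : v ≠ t := fun h => htv h.symm
    have h3 := piPerc_inter_le_prod₃_of_witnessedι₀₁ p (C := clsSet u u t z 0 1) hE IotaB1.cls₁_facts htu hzu
      (mkn (l0n (stepVec ι) u z) u v t z x) (isFinitary_mkn (isFinitary_l0n _ u z) u v t z x)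
      grpιI₀₁ grpιI₀₁_adm
      (fun ω _ hlat i K hK _ hL hI _ => by
        fin_cases i
        · exact mem_event_ge_three_zero_stepVec hlat hK hL (hI (by decide))
        · exact mem_openConnGe_zero_of_mem hL
        · exact mem_openConnGe_zero_of_mem hL
        · have hL' : K ∈ (openConn u z : Set (BondConfig (Site d))) := hL
          exact mem_openConnGe_one_of_ne (SimpleGraph.Reachable.symm hL') hzu
        · exact mem_openConnGe_zero_of_mem hL)
      (mem_openConnEq_one_of_mem huv (Set.mem_singleton _)) (mem_openConnEq_one_of_mem htz (Set.mem_singleton _))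
      (up₁n hvt hzx htx)
    refine h3.trans (mul_le_mul' (mul_le_mul' ?_ ?_) ?_)
    · exact piPerc_grp_le _ _ _ 0 ![Sum.inl (Sum.inl 0), Sum.inl (Sum.inl 1), Sum.inl (Sum.inl 4)] (by decide)
        (by decide) (by funext m; fin_cases m <;> rfl) (piPerc_iotaStart_zero_le_blockPiota p ι u _ rfl)
    · exact piPerc_grp_le _ _ _ 1 ![Sum.inl (Sum.inr 0), Sum.inr 0, Sum.inl (Sum.inr 1), Sum.inl (Sum.inl 3)]
        (by decide) (by decide) (by funext m; fin_cases m <;> rfl) (piPerc_mid_n_le p u v t z _)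
    · exact piPerc_grp_le _ _ _ 2 ![Sum.inr 2, Sum.inr 1, Sum.inr 3] (by decide) (by decide)
        (by funext m; fin_cases m <;> rfl) (piPerc_end_one_le_blockPE p htx hzx _)

end Literature.Probability.FitznerVanDerHofstad2017
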